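import Literature.NumberTheory.Automorphic.FLSThreeFiveSwitchingProofs
import HarnessLib

/-!
# Freitas–Le Hung–Siksek 2015, Theorem 2: modularity lifting for elliptic curves over totally real
# fields at an odd prime `p` — with NO extra condition at `p = 5` (named fact)

Topic `Literature/NumberTheory/Automorphic`; companion of `FLSResidualImageCriteria.lean`
(`FLS2015_theorem3`, `FLS2015_theorem4`), `FreitasLeHungSiksekLifting.lean` (`FLS2015_theorems3_4`),
`HilbertResidualModularity.lean` (the carrier `ModPGaloisRep.IsHilbertModular` = "`ρ̄` is modular",
§1 of the source) and `FLSThreeFiveSwitchingProofs.lean`, which writes Theorem 2 OUT as the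
hypothesis `h2` of its assemblies (`FLS2015.corollary5_1_of_theorem6_of_theorem2`,
`FLS2015.liftingAtFive_of_theorem2`, `FLS2015_theorem3_of_theorem6_of_theorem2_of_switching`, …) and
records (module docstring, "Rendering") that "Thm. 2 itself ha[s] no carrier-less obstruction and
[is] NOT restated (D-0026)" there, those being prover seats.  This literature file VENDORS it: ONE
named fact `FLS2015_theorem2` (D-0014; users take `(h : FLS2015_theorem2)`), token for token the
binder `h2` of those assemblies, so that every one of them is now a theorem about named facts
(bookkeeping below).  Typed for the cell `pub/lg-quartmod` (F-L1: elliptic curves over totally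
real quartic fields containing `√5`), for which the point of the theorem is its `p = 5` clause:
**the statement carries no hypothesis on `√5 ∈ K` and no hypothesis on the projective image of
`ρ̄|_{G_{K(ζ₅)}}`** — see "The `p = 5` paragraph" below.  Nothing in this file proves modularity of
anything: the fact is a cited hypothesis, and the theorems are reductions.

## What the source prints (held text `paper:arxiv-1310.7088`)

N. Freitas, B. V. Le Hung, S. Siksek, *Elliptic curves over real quadratic fields are modular*,
Invent. Math. 201 (2015) 159–206 [FreitasLeHungSiksek2015].

* §1, p. 4: "the following is a relatively straightforward consequence of a theorem of Breuil and
  Diamond [BreuilDiamond, Thm. 3.2.2], which in turn is a consequence of deep results due to Kisin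
  [Kisin], Gee [Gee], and Barnet-Lamb, Gee and Geraghty [BGG1], [BGG2].  **Theorem 2.** Let `E` be
  an elliptic curve over a totally real number field `K`, and let `p ≠ 2` be a rational prime.
  Write `ρ̄ = ρ̄_{E,p}`. Suppose (i) `ρ̄` is modular, (ii) `ρ̄(G_{K(ζ_p)})` is absolutely
  irreducible. Then `E` is modular."  With (§1, p. 4): "We say `ρ̄_{E,p}` is modular if there
  exists a Hilbert cuspidal eigenform `𝔣` over `K` of parallel weight `2`, and a place `λ ∣ p` of
  `ℚ̄` such that `ρ̄^{ss}_{E,p} ∼ ρ̄^{ss}_{𝔣,λ}`", and "`E` is modular if there exists a Hilbert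
  cuspidal eigenform `𝔣` over `K` of parallel weight `2`, with rational Hecke eigenvalues, such
  that the Hasse–Weil L-function of `E` is equal to the L-function of `𝔣`".
* **The `p = 5` paragraph** (§2 "Modularity lifting: proof of Theorem 2", p. 8): "If `p ≠ 5`, the
  conditions of [BreuilDiamond] are satisfied […] so `ρ` is modular. When `p = 5`, the theorem has
  an extra hypothesis: namely that the projective image of `ρ̄|_{G_{K(ζ₅)}}` is not `PSL₂(𝔽₅)`. The
  reason for this additional hypothesis is to assure the existence of Taylor–Wiles systems (as in
  [Kisin]). However, in our situation, because `det ρ̄` is the mod `5` cyclotomic character, we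
  can still choose Taylor–Wiles systems without this extra condition, as we now explain. […]
  Because `H¹(PSL₂(𝔽₅), Sym² 𝔽₅²) = 𝔽₅` does not vanish, the extra condition when `p = 5` was used
  to exclude the possibility that `Gal(K₀/K) = PSL₂(𝔽₅)` and `ζ₅ ∈ K₀`. But using the fact that
  `ρ̄` has cyclotomic determinant, we can get rid of it as follows. Suppose the above happens, then
  `√5 ∈ K` because `det : ρ̄(G_K) → PGL₂(𝔽₅) → 𝔽₅^*/(𝔽₅^*)²` is induced by the cyclotomic
  character. But `ζ₅ ∈ K₀ ∖ K` implies that `Gal(K₀/K)` has a quotient of order `2`. As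
  `Gal(K₀/K) ≅ PSL₂(𝔽₅) ≅ A₅`, we have a contradiction."  (Kisin's form of the condition —
  Ann. of Math. 170 (2009), (3.2.3)(3): "If `p = 5`, and `ρ̄` has projective image isomorphic to
  `PGL₂(𝔽₅)`, then the kernel of `proj ρ̄` does not fix `F(ζ₅)`" — is typed, with its vacuity for
  `ρ̄_{E,5}` over `K ∋ √5` PROVED, in `KisinTaylorWilesHypothesisFive.lean`.)

## Rendering (that of `FLSThreeFiveSwitchingProofs.lean`, binder `h2`, verbatim)

* `E / K` ⟶ an integral Weierstrass model `E / 𝓞 K` with `Δ(E) ≠ 0` (every elliptic curve over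
  `K` has one); "`E` is modular" ⟶ `IsAutomorphicOfWeightZero E` (module docstring of
  `TotallyRealModularity.lean`, "Rendering and faithfulness": a weight-zero cuspidal `π` of
  `GL₂(𝔸_K)` with Hecke polynomial `X² − a_w X + q_w` at every `w ∤ Δ(E)`).
* `ρ̄ = ρ̄_{E,p}` ⟶ any framing `ρ̄ : Γ_K →ₜ* GL₂(𝔽_p)` of the Galois action on the geometric
  `p`-torsion, `WeierstrassCurve.IsTorsionGaloisRep (E ⊗ K) p ρ̄` (all framings are conjugate,
  `IsTorsionGaloisRep.exists_conj_eq`).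
* (i) "`ρ̄` is modular" ⟶ `ρ̄.IsHilbertModular` (`HilbertResidualModularity.lean`: a weight-zero
  cuspidal `π`, a coefficient ring `O → ℂ`, a reduction `O → 𝔽_p`, and at almost all `w` matching
  Hecke polynomial of `π` and Frobenius characteristic polynomial of `ρ̄` — "`ρ̄^{ss} ∼ ρ̄^{ss}_{𝔣,λ}`"
  by Chebotarev and Brauer–Nesbitt) for EVERY framing; equivalently for SOME framing, modularity
  being frame-independent (`IsTorsionGaloisRep.isHilbertModular_of_isTorsionGaloisRep`;
  `FLS2015_theorem2.of_exists` below).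
* (ii) "`ρ̄(G_{K(ζ_p)})` absolutely irreducible" ⟶ `ModPImageAbsIrreducibleOverCyclotomic (E ⊗ K) p`
  (`TotallyRealModularityLargeImage.lean`: every framing restricted to every model of `K(ζ_p)` is
  absolutely irreducible), exactly as in `FLS2015_theorem3/4`.
* `p ≠ 2` prime: `(p : ℕ) [Fact p.Prime]`, `p ≠ 2`.  NO further hypothesis — in particular none at
  `p = 5`.

## Contents

* `FLS2015_theorem2` — the named fact.
* `FLS2015_theorem2.of_exists` — hypothesis (i) from ONE modular framing.
* `FLS2015_theorem2.of_congruence` — the form used by every switching argument: if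
  `E[p] ≅ E′[p]` (a common framing) for a MODULAR `E′` and `ρ̄_{E,p}(G_{K(ζ_p)})` is absolutely
  irreducible, then `E` is modular (`IsTorsionGaloisRep.isHilbertModular`: "Thus
  `ρ̄_{E,5} ∼ ρ̄_{E′,5}` is modular", §6); at `p = 5` this is literally the binder `h2` of
  `FLS2015.theorem3_five_of_switching` (`FLS2015_theorem2.liftingAtFive`).
* `FLS2015_theorem2.corollary5_1_of_theorem6`, `FLS2015_theorem3_of_theorem6_of_switching`,
  `FLS2015_theorem3_of_strongArtin_of_weightTwo_of_switching` — the assemblies of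
  `FLSThreeFiveSwitchingProofs.lean` with `h2` discharged by the fact: **`FLS2015_theorem3` is
  closed modulo `FLS2015_theorem2`, Theorem 6 (resp. `strongArtin_of_isSolvable` + the weight-two
  step of [DF2]) and Lemma 6.1**.
* `FLS2015_theorem2.isModularEllipticCurve` — the trace-only weak conclusion used summit-side.

## References

* [FreitasLeHungSiksek2015] Invent. Math. 201 (2015) 159–206 = arXiv:1310.7088: Thm. 2 and the
  definitions of "modular" (§1, held text p. 4); §2, proof of Thm. 2 incl. the `p = 5` paragraph
  (held text p. 8); Cor. 5.1, Thm. 6 (§5), Lemma 6.1 and the proof of Thm. 3 (§6).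
* [BreuilDiamond2014] C. Breuil, F. Diamond, *Formes modulaires de Hilbert modulo `p` et valeurs
  d'extensions entre caractères galoisiens*, Ann. Sci. ÉNS 47 (2014), Thm. 3.2.2 (the source's
  [BreuilDiamond]); [KisinModuli2009] M. Kisin, Ann. of Math. 170 (2009), (3.2.3)(3), Thm. (3.5.7)
  (the source's [Kisin]; tree: `KisinTaylorWilesHypothesisFive.lean`).
-/

open scoped NumberField MatrixGroups
open NumberField Field Matrix Literature.NumberTheory.GaloisRepresentations

noncomputable section

namespace Literature.NumberTheory.Automorphic

/-! ### The named fact -/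

/-- **Freitas–Le Hung–Siksek 2015, Theorem 2 (modularity lifting for elliptic curves over totally
real fields, `p` odd).** "Let `E` be an elliptic curve over a totally real number field `K`, and
let `p ≠ 2` be a rational prime. Write `ρ̄ = ρ̄_{E,p}`. Suppose (i) `ρ̄` is modular, (ii)
`ρ̄(G_{K(ζ_p)})` is absolutely irreducible. Then `E` is modular."  Rendered (module docstring
"Rendering", = the binder `h2` of `FLSThreeFiveSwitchingProofs.lean` verbatim): for `K` a totally
real number field, `E / 𝓞 K` with `Δ(E) ≠ 0`, `p ≠ 2` prime, if EVERY framing `ρ̄` of `(E ⊗ K)[p]`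
is modular (`ρ̄.IsHilbertModular`; equivalently some framing, `FLS2015_theorem2.of_exists`) and
`ρ̄_{E,p}(G_{K(ζ_p)})` is absolutely irreducible (`ModPImageAbsIrreducibleOverCyclotomic`), then
`IsAutomorphicOfWeightZero E`.  NO hypothesis at `p = 5` beyond these: the source removes
Breuil–Diamond's extra condition "projective image of `ρ̄|_{G_{K(ζ₅)}}` is not `PSL₂(𝔽₅)`" for
`ρ̄ = ρ̄_{E,5}` using `det ρ̄ = χ̄₅` (§2, p. 8, quoted in the module docstring) — the case `√5 ∈ K`
included.  Proof in print: Breuil–Diamond Thm. 3.2.2 (Kisin, Gee, Barnet-Lamb–Gee–Geraghty); no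
carrier for modularity lifting in the tree — a named fact (D-0014): users take
`(h : FLS2015_theorem2)`. [cite: FreitasLeHungSiksek2015, Thm. 2 (§1 p. 4) and §2 (proof, incl. the p = 5 paragraph, p. 8)] -/
def FLS2015_theorem2 : Prop :=
  ∀ (K : Type) [Field K] [NumberField K] [IsTotallyReal K] (E : WeierstrassCurve (𝓞 K)),
    E.Δ ≠ 0 → ∀ (p : ℕ) [Fact p.Prime], p ≠ 2 →
      (∀ ρ : ModPGaloisRep K (ZMod p) 2, (E.baseChange K).IsTorsionGaloisRep p ρ →
        ρ.IsHilbertModular) →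
      ModPImageAbsIrreducibleOverCyclotomic (E.baseChange K) p → IsAutomorphicOfWeightZero E

/-! ### Hypothesis (i) from one framing; the congruence form -/

/-- **Theorem 2 with (i) for SOME framing.** "`ρ̄_{E,p}` is modular" is a property of the Galois
module `E[p]`: if one framing is modular, all are
(`IsTorsionGaloisRep.isHilbertModular_of_isTorsionGaloisRep`), so the fact applies.
[cite: FreitasLeHungSiksek2015, Thm. 2] -/
theorem FLS2015_theorem2.of_exists (h : FLS2015_theorem2) (K : Type) [Field K] [NumberField K]
    [IsTotallyReal K] (E : WeierstrassCurve (𝓞 K)) (hΔ : E.Δ ≠ 0) (p : ℕ) [Fact p.Prime]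
    (hp : p ≠ 2)
    (hmod : ∃ ρ₀ : ModPGaloisRep K (ZMod p) 2, (E.baseChange K).IsTorsionGaloisRep p ρ₀ ∧
      ρ₀.IsHilbertModular)
    (himg : ModPImageAbsIrreducibleOverCyclotomic (E.baseChange K) p) :
    IsAutomorphicOfWeightZero E := by
  obtain ⟨ρ₀, hρ₀, hmod₀⟩ := hmod
  exact h K E hΔ p hp (fun ρ hρ => hρ.isHilbertModular_of_isTorsionGaloisRep hρ₀ hmod₀) himg

/-- **Theorem 2 in congruence form** (how the source uses it in §§6–7): if `E[p] ≅ E′[p]` as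
Galois modules — one common framing `ρ̄₀` of both — for a MODULAR `E′ / 𝓞 K` (`Δ(E′) ≠ 0`,
`IsAutomorphicOfWeightZero E′`), then (i) holds for `E` ("Thus `ρ̄_{E,5} ∼ ρ̄_{E′,5}` is modular",
§6; `IsTorsionGaloisRep.isHilbertModular`), so if moreover `ρ̄_{E,p}(G_{K(ζ_p)})` is absolutely
irreducible, `E` is modular. [cite: FreitasLeHungSiksek2015, Thm. 2 and §6 (proof of Thm. 3 for p = 5)] -/
theorem FLS2015_theorem2.of_congruence (h : FLS2015_theorem2) (K : Type) [Field K]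
    [NumberField K] [IsTotallyReal K] (E : WeierstrassCurve (𝓞 K)) (hΔ : E.Δ ≠ 0) (p : ℕ)
    [Fact p.Prime] (hp : p ≠ 2)
    (hE' : ∃ E' : WeierstrassCurve (𝓞 K), E'.Δ ≠ 0 ∧ IsAutomorphicOfWeightZero E' ∧
      ∃ ρ : ModPGaloisRep K (ZMod p) 2,
        (E.baseChange K).IsTorsionGaloisRep p ρ ∧ (E'.baseChange K).IsTorsionGaloisRep p ρ)
    (himg : ModPImageAbsIrreducibleOverCyclotomic (E.baseChange K) p) :
    IsAutomorphicOfWeightZero E := by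
  obtain ⟨E', hΔ', hE', ρ₀, hρ₀, hρ₀'⟩ := hE'
  exact h.of_exists K E hΔ p hp ⟨ρ₀, hρ₀, hρ₀'.isHilbertModular hΔ' hE'⟩ himg

/-- **Theorem 2 at `p = 5` in the form consumed by the `3–5` switch** — literally the binder `h2`
of `FLS2015.theorem3_five_of_switching` / `Thorne2016_theorem7_6_of_liftingAtFive`
(`FLS2015.liftingAtFive_of_theorem2` fed with the fact).  Over `K ∋ √5` as over any totally real
`K`: no side condition. [cite: FreitasLeHungSiksek2015, Thm. 2 and §6] -/
theorem FLS2015_theorem2.liftingAtFive (h : FLS2015_theorem2) (K : Type) [Field K]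
    [NumberField K] [IsTotallyReal K] (E : WeierstrassCurve (𝓞 K)) (hΔ : E.Δ ≠ 0) (p : ℕ)
    [Fact p.Prime] (hp : p = 5)
    (hE' : ∃ E' : WeierstrassCurve (𝓞 K), E'.Δ ≠ 0 ∧ IsAutomorphicOfWeightZero E' ∧
      ∃ ρ : ModPGaloisRep K (ZMod p) 2,
        (E.baseChange K).IsTorsionGaloisRep p ρ ∧ (E'.baseChange K).IsTorsionGaloisRep p ρ)
    (himg : ModPImageAbsIrreducibleOverCyclotomic (E.baseChange K) p) :
    IsAutomorphicOfWeightZero E :=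
  FLS2015.liftingAtFive_of_theorem2 h K E hΔ p hp hE' himg

/-! ### The assemblies of `FLSThreeFiveSwitchingProofs.lean`, with Theorem 2 now a named fact -/

/-- **Corollary 5.1 = Theorem 6 + Theorem 2 at `p = 3`** ("an immediate corollary of
Langlands–Tunnell and Theorem 2. It is of course Theorem 3 with `p = 3`", §5), with Thm. 2 the
named fact and Thm. 6 ("`ρ̄_{E,3}` irreducible ⇒ `ρ̄_{E,3}` modular") the remaining hypothesis.
[cite: FreitasLeHungSiksek2015, Cor. 5.1 (§5), Thm. 6, Thm. 2] -/
theorem FLS2015_theorem2.corollary5_1_of_theorem6 (h : FLS2015_theorem2)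
    (h6 : ∀ (K : Type) [Field K] [NumberField K] [IsTotallyReal K] (E : WeierstrassCurve (𝓞 K)),
      E.Δ ≠ 0 → ∀ ρ : ModPGaloisRep K (ZMod 3) 2, (E.baseChange K).IsTorsionGaloisRep 3 ρ →
        FramedRep.IsIrreducible ρ → ρ.IsHilbertModular)
    (K : Type) [Field K] [NumberField K] [IsTotallyReal K] (E : WeierstrassCurve (𝓞 K))
    (hΔ : E.Δ ≠ 0) (p : ℕ) [Fact p.Prime] (hp : p = 3)
    (himg : ModPImageAbsIrreducibleOverCyclotomic (E.baseChange K) p) :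
    IsAutomorphicOfWeightZero E :=
  FLS2015.corollary5_1_of_theorem6_of_theorem2 h6 h K E hΔ p hp himg

/-- **`FLS2015_theorem3` closed modulo the named fact `FLS2015_theorem2`, Theorem 6 and Lemma 6.1**
(the printed proof of Thm. 3: `FLS2015_theorem3_of_theorem6_of_theorem2_of_switching` with `h2`
the fact).  The two remaining hypotheses are printed theorems of the source without carrier-free
statements in the tree: Thm. 6 (§5: Langlands–Tunnell over `K` + the weight shift of [DF2]) and
Lemma 6.1 (§6: `X_E(5) ≅ ℙ¹`, Hilbert irreducibility, a `3`-adically large auxiliary curve `E′`).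
[cite: FreitasLeHungSiksek2015, Thm. 3 and its proof (Cor. 5.1, §6), Thm. 2, Thm. 6, Lemma 6.1] -/
theorem FLS2015_theorem3_of_theorem6_of_switching (h : FLS2015_theorem2)
    (h6 : ∀ (K : Type) [Field K] [NumberField K] [IsTotallyReal K] (E : WeierstrassCurve (𝓞 K)),
      E.Δ ≠ 0 → ∀ ρ : ModPGaloisRep K (ZMod 3) 2, (E.baseChange K).IsTorsionGaloisRep 3 ρ →
        FramedRep.IsIrreducible ρ → ρ.IsHilbertModular)
    (h61 : ∀ (K : Type) [Field K] [NumberField K] (E : WeierstrassCurve (𝓞 K)), E.Δ ≠ 0 →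
      ∃ E' : WeierstrassCurve (𝓞 K), E'.Δ ≠ 0 ∧
        (∃ ρ : ModPGaloisRep K (ZMod 5) 2,
          (E.baseChange K).IsTorsionGaloisRep 5 ρ ∧ (E'.baseChange K).IsTorsionGaloisRep 5 ρ) ∧
        ∃ ρ₃ : FramedGaloisRep K (ZMod 3) 2, (E'.baseChange K).IsTorsionGaloisRep 3 ρ₃ ∧
          ∀ g : Matrix.SpecialLinearGroup (Fin 2) (ZMod 3), ∃ σ,
            ρ₃ σ = Matrix.SpecialLinearGroup.toGL g) :
    FLS2015_theorem3 :=
  FLS2015_theorem3_of_theorem6_of_theorem2_of_switching h6 h h61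

/-- **`FLS2015_theorem3` closed modulo `FLS2015_theorem2`, `strongArtin_of_isSolvable`, the
weight-two step of Theorem 6 and Lemma 6.1** — `FLS2015_theorem3_of_strongArtin_of_weightTwo_of_theorem2_of_switching`
with `h2` the fact: of the printed inputs of Thm. 3 only the [DF2] weight shift (`hW2`) and
Lemma 6.1 (`h61`) remain un-named. [cite: FreitasLeHungSiksek2015, Thm. 3, Thm. 6 (§5), Thm. 2, Lemma 6.1]
[cite: Gelbart1997, Thm. 2.1] -/
theorem FLS2015_theorem3_of_strongArtin_of_weightTwo_of_switching (h : FLS2015_theorem2)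
    (hSA : strongArtin_of_isSolvable)
    (hW2 : ∀ (K : Type) [Field K] [NumberField K] [IsTotallyReal K] (E : WeierstrassCurve (𝓞 K)),
      E.Δ ≠ 0 → ∀ ρ : ModPGaloisRep K (ZMod 3) 2, (E.baseChange K).IsTorsionGaloisRep 3 ρ →
        (∃ (hcpt : isCompact_glFiniteIntegralLevel 2 K) (π : CuspidalAutomorphicRepData 2 K hcpt),
            IsPiOfArtinRep (modThreeLift ρ) π.1) → ρ.IsHilbertModular)
    (h61 : ∀ (K : Type) [Field K] [NumberField K] (E : WeierstrassCurve (𝓞 K)), E.Δ ≠ 0 →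
      ∃ E' : WeierstrassCurve (𝓞 K), E'.Δ ≠ 0 ∧
        (∃ ρ : ModPGaloisRep K (ZMod 5) 2,
          (E.baseChange K).IsTorsionGaloisRep 5 ρ ∧ (E'.baseChange K).IsTorsionGaloisRep 5 ρ) ∧
        ∃ ρ₃ : FramedGaloisRep K (ZMod 3) 2, (E'.baseChange K).IsTorsionGaloisRep 3 ρ₃ ∧
          ∀ g : Matrix.SpecialLinearGroup (Fin 2) (ZMod 3), ∃ σ,
            ρ₃ σ = Matrix.SpecialLinearGroup.toGL g) :
    FLS2015_theorem3 :=
  FLS2015_theorem3_of_strongArtin_of_weightTwo_of_theorem2_of_switching hSA hW2 h h61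

/-! ### Weak conclusion -/

/-- Theorem 2 with the trace-only conclusion `IsModularEllipticCurve K E` of Caraiani–Newton (the
notion the summit-side statements write out), via
`IsModularEllipticCurve.of_isAutomorphicOfWeightZero`. [cite: FreitasLeHungSiksek2015, Thm. 2] -/
theorem FLS2015_theorem2.isModularEllipticCurve (h : FLS2015_theorem2) (K : Type) [Field K]
    [NumberField K] [IsTotallyReal K] (E : WeierstrassCurve (𝓞 K)) (hΔ : E.Δ ≠ 0) (p : ℕ)
    [Fact p.Prime] (hp : p ≠ 2)
    (hmod : ∀ ρ : ModPGaloisRep K (ZMod p) 2, (E.baseChange K).IsTorsionGaloisRep p ρ →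
      ρ.IsHilbertModular)
    (himg : ModPImageAbsIrreducibleOverCyclotomic (E.baseChange K) p) :
    IsModularEllipticCurve K E :=
  IsModularEllipticCurve.of_isAutomorphicOfWeightZero hΔ (h K E hΔ p hp hmod himg)

end Literature.NumberTheory.Automorphic

end
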